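import Literature.Probability.Percolation.BernoulliPercolation
import Literature.Probability.Percolation.SeedLemma
import Literature.Probability.LatticeModels.ThermodynamicLimit
import HarnessLib

/-!
# `stub_pos` of line `Sketch` (crux `PercTreeValue.EquilateralAntiFactorisation`,
# stmt-CriticalPhenomena-7800): positivity of the triple box event

For `p > 0` and `r ≤ n` the event `{0 ↔ a_r in Λ_n} ∩ {0 ↔ b_r in Λ_n}` (`a_r = (r,r,0)`,
`b_r = (r,0,r)`, `Λ_n = box 3 n = [-n,n]³`) has positive `P_p`-probability. Proof: let `F` be the
finite set of nearest-neighbour edges of `ℤ³` with both endpoints in `Λ_n`; then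
`P_p(F ⊆ ω) = p^{|F|} > 0` (`bondPercolation_real_setOf_subset`), and on `{F ⊆ ω}` the monotone
lattice staircases `0 → (r,0,0) → (r,r,0)` and `0 → (r,0,0) → (r,0,r)`, all of whose vertices have
coordinates in `[0, r] ⊆ [-n, n]`, are open paths of `Λ_n`; conclude by monotonicity of `P_p`.
No definitions are introduced: the edge set `F` is a local term of the final proof and the
staircases are explicit lambdas. (Worker draft by stub-worker `w-pos`, de-`def`'d by the lead.)
-/

noncomputable section

namespace Summit.CriticalPhenomena.PercolationContinuityZ3.Theorems.EquilateralAntiFactorisation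

open MeasureTheory
open Literature.Probability.Percolation Literature.Probability.LatticeModels

namespace Pos

/-- If `F` contains every lattice edge with both endpoints in `Λ_n` and every pair of `F` is open
in `ω`, then lattice-adjacent points of `Λ_n` are adjacent in the open graph of `ω`. -/
theorem openGraph_adj_of_subset {n : ℕ} {F : Set (Sym2 (Site 3))}
    (hF : ∀ u v : Site 3, u ∈ box 3 n → v ∈ box 3 n → (zdGraph 3).Adj u v → s(u, v) ∈ F)
    {ω : BondConfig (Site 3)} (hω : F ⊆ ω) {u v : Site 3} (hu : u ∈ box 3 n)
    (hv : v ∈ box 3 n) (h : (zdGraph 3).Adj u v) : (openGraph ω).Adj u v :=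
  (openGraph_adj ω u v).2 ⟨hω (hF u v hu hv h), h.ne⟩

/-- Walking along `γ 0, γ 1, …, γ k`: if each `γ (j+1)` (`j < k`) lies in `S` and is joined to
`γ j` by an open edge, and `γ 0 ∈ S`, then `{γ 0 ↔ γ k in S}` holds. -/
theorem openConnIn_of_steps {V : Type*} {S : Set V} {ω : BondConfig V} (γ : ℕ → V)
    (h0 : γ 0 ∈ S) : ∀ k : ℕ,
      (∀ j < k, γ (j + 1) ∈ S ∧ (openGraph ω).Adj (γ j) (γ (j + 1))) →
        ω ∈ openConnIn S (γ 0) (γ k)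
  | 0, _ => ⟨h0, h0, SimpleGraph.Reachable.refl _⟩
  | k + 1, h => by
    obtain ⟨h0', hk, hr⟩ :=
      openConnIn_of_steps γ h0 k fun j hj => h j (Nat.lt_succ_of_lt hj)
    have hk1 := h k k.lt_succ_self
    exact ⟨h0', hk1.1, hr.trans (SimpleGraph.Adj.reachable
      (show ((openGraph ω).induce S).Adj ⟨γ k, hk⟩ ⟨γ (k + 1), hk1.1⟩ from hk1.2))⟩

/-- The first leg `j ↦ (j, 0, 0)` stays in `Λ_n` for `j ≤ n`. -/
theorem seg₁_mem {n j : ℕ} (hj : j ≤ n) : (![(j : ℤ), 0, 0] : Site 3) ∈ box 3 n := by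
  rw [mem_box]; intro i; fin_cases i <;> simp
  omega

/-- The second leg `j ↦ (r, j, 0)` towards `a_r` stays in `Λ_n` for `r, j ≤ n`. -/
theorem seg₂_mem {n r j : ℕ} (hr : r ≤ n) (hj : j ≤ n) :
    (![(r : ℤ), (j : ℤ), 0] : Site 3) ∈ box 3 n := by
  rw [mem_box]; intro i; fin_cases i <;> simp <;> omega

/-- The second leg `j ↦ (r, 0, j)` towards `b_r` stays in `Λ_n` for `r, j ≤ n`. -/
theorem seg₃_mem {n r j : ℕ} (hr : r ≤ n) (hj : j ≤ n) :
    (![(r : ℤ), 0, (j : ℤ)] : Site 3) ∈ box 3 n := by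
  rw [mem_box]; intro i; fin_cases i <;> simp <;> omega

/-- Consecutive points of the first leg are lattice neighbours (direction `e₀`). -/
theorem seg₁_adj (j : ℕ) :
    (zdGraph 3).Adj (![(j : ℤ), 0, 0] : Site 3) ![((j + 1 : ℕ) : ℤ), 0, 0] :=
  (zdGraph_adj_iff _ _).2 ⟨0, Or.inl (by ext i; fin_cases i <;> simp)⟩

/-- Consecutive points of the second leg towards `a_r` are lattice neighbours (direction `e₁`). -/
theorem seg₂_adj (r j : ℕ) :
    (zdGraph 3).Adj (![(r : ℤ), (j : ℤ), 0] : Site 3) ![(r : ℤ), ((j + 1 : ℕ) : ℤ), 0] :=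
  (zdGraph_adj_iff _ _).2 ⟨1, Or.inl (by ext i; fin_cases i <;> simp)⟩

/-- Consecutive points of the second leg towards `b_r` are lattice neighbours (direction `e₂`). -/
theorem seg₃_adj (r j : ℕ) :
    (zdGraph 3).Adj (![(r : ℤ), 0, (j : ℤ)] : Site 3) ![(r : ℤ), 0, ((j + 1 : ℕ) : ℤ)] :=
  (zdGraph_adj_iff _ _).2 ⟨2, Or.inl (by ext i; fin_cases i <;> simp)⟩

/-- **Key inclusion.** If `F` contains every lattice edge inside `Λ_n` and all of `F` is open,
then `0 ↔ a_r` and `0 ↔ b_r` inside `Λ_n` (`r ≤ n`), via the two staircases. -/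
theorem setOf_subset_inter {n r : ℕ} (hrn : r ≤ n) {F : Set (Sym2 (Site 3))}
    (hF : ∀ u v : Site 3, u ∈ box 3 n → v ∈ box 3 n → (zdGraph 3).Adj u v → s(u, v) ∈ F) :
    {ω : BondConfig (Site 3) | F ⊆ ω} ⊆
      openConnIn (↑(box 3 n) : Set (Site 3)) (0 : Site 3) ![(r : ℤ), (r : ℤ), 0] ∩
        openConnIn (↑(box 3 n) : Set (Site 3)) (0 : Site 3) ![(r : ℤ), 0, (r : ℤ)] := by
  intro ω hω
  -- leg 1: 0 → (r,0,0)
  have h1 : ω ∈ openConnIn (↑(box 3 n) : Set (Site 3)) (![((0 : ℕ) : ℤ), 0, 0] : Site 3)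
      ![(r : ℤ), 0, 0] :=
    openConnIn_of_steps (fun j : ℕ => (![(j : ℤ), 0, 0] : Site 3))
      (Finset.mem_coe.2 (seg₁_mem (Nat.zero_le n))) r fun j hj =>
      ⟨Finset.mem_coe.2 (seg₁_mem (by omega)),
        openGraph_adj_of_subset hF hω (seg₁_mem (by omega)) (seg₁_mem (by omega)) (seg₁_adj j)⟩
  -- leg 2a: (r,0,0) → (r,r,0)
  have h2 : ω ∈ openConnIn (↑(box 3 n) : Set (Site 3)) (![(r : ℤ), ((0 : ℕ) : ℤ), 0] : Site 3)
      ![(r : ℤ), (r : ℤ), 0] :=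
    openConnIn_of_steps (fun j : ℕ => (![(r : ℤ), (j : ℤ), 0] : Site 3))
      (Finset.mem_coe.2 (seg₂_mem hrn (Nat.zero_le n))) r fun j hj =>
      ⟨Finset.mem_coe.2 (seg₂_mem hrn (by omega)),
        openGraph_adj_of_subset hF hω (seg₂_mem hrn (by omega)) (seg₂_mem hrn (by omega))
          (seg₂_adj r j)⟩
  -- leg 2b: (r,0,0) → (r,0,r)
  have h3 : ω ∈ openConnIn (↑(box 3 n) : Set (Site 3)) (![(r : ℤ), 0, ((0 : ℕ) : ℤ)] : Site 3)
      ![(r : ℤ), 0, (r : ℤ)] :=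
    openConnIn_of_steps (fun j : ℕ => (![(r : ℤ), 0, (j : ℤ)] : Site 3))
      (Finset.mem_coe.2 (seg₃_mem hrn (Nat.zero_le n))) r fun j hj =>
      ⟨Finset.mem_coe.2 (seg₃_mem hrn (by omega)),
        openGraph_adj_of_subset hF hω (seg₃_mem hrn (by omega)) (seg₃_mem hrn (by omega))
          (seg₃_adj r j)⟩
  have e0 : (![((0 : ℕ) : ℤ), 0, 0] : Site 3) = 0 := by
    ext i; fin_cases i <;> simp
  have e2 : (![(r : ℤ), ((0 : ℕ) : ℤ), 0] : Site 3) = ![(r : ℤ), 0, 0] := by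
    ext i; fin_cases i <;> simp
  have e3 : (![(r : ℤ), 0, ((0 : ℕ) : ℤ)] : Site 3) = ![(r : ℤ), 0, 0] := by
    ext i; fin_cases i <;> simp
  rw [e0] at h1
  rw [e2] at h2
  rw [e3] at h3
  exact ⟨GM.openConnIn_trans h1 h2, GM.openConnIn_trans h1 h3⟩

end Pos

/-- **S4 (positivity).** For `p > 0` and `r ≤ n` the triple box event
`{0 ↔ a_r in Λ_n} ∩ {0 ↔ b_r in Λ_n}` (`a_r = (r,r,0)`, `b_r = (r,0,r)`, `Λ_n = [-n,n]³`) has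
positive `P_p`-probability: it contains the event that all lattice edges inside `Λ_n` are open,
of probability `p^{#edges} > 0`. -/
theorem stub_pos (p : unitInterval) (hp : 0 < (p : ℝ)) (n r : ℕ) (hrn : r ≤ n) :
    0 < (bondPercolation (zdGraph 3) p).real
      (openConnIn (↑(box 3 n) : Set (Site 3)) (0 : Site 3) ![(r : ℤ), (r : ℤ), 0] ∩
        openConnIn (↑(box 3 n) : Set (Site 3)) (0 : Site 3) ![(r : ℤ), 0, (r : ℤ)]) := by
  classical
  -- the lattice edges with both endpoints in the box, as a local term (no definition introduced)
  set F : Finset (Sym2 (Site 3)) :=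
    ((box 3 n ×ˢ box 3 n).filter fun uv => (zdGraph 3).Adj uv.1 uv.2).image fun uv => s(uv.1, uv.2)
  have hFE : (↑F : Set (Sym2 (Site 3))) ⊆ (zdGraph 3).edgeSet := by
    intro e he
    obtain ⟨uv, huv, rfl⟩ := Finset.mem_image.1 (Finset.mem_coe.1 he)
    exact (Finset.mem_filter.1 huv).2
  have hF : ∀ u v : Site 3, u ∈ box 3 n → v ∈ box 3 n → (zdGraph 3).Adj u v →
      s(u, v) ∈ (↑F : Set (Sym2 (Site 3))) := fun u v hu hv h =>
    Finset.mem_coe.2 (Finset.mem_image.2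
      ⟨(u, v), Finset.mem_filter.2 ⟨Finset.mem_product.2 ⟨hu, hv⟩, h⟩, rfl⟩)
  calc (0 : ℝ) < (p : ℝ) ^ F.card := pow_pos hp _
    _ = (bondPercolation (zdGraph 3) p).real {ω | (↑F : Set (Sym2 (Site 3))) ⊆ ω} :=
      (bondPercolation_real_setOf_subset (zdGraph 3) p F hFE).symm
    _ ≤ _ := measureReal_mono (Pos.setOf_subset_inter hrn hF)

end Summit.CriticalPhenomena.PercolationContinuityZ3.Theorems.EquilateralAntiFactorisation

end
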